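import Literature.Analysis.Asymptotics.LogarithmicSummabilityTauberianProofs
import Summits.QuantumFields.BalabanUV.Beta.EriceFlowEnclosureLogMeanEscape

/-!
# Beta / EriceFlowEnclosureLogMeanPowerScales — THE HONEST TAUBERIAN CLASS OF THE LOGARITHMIC CUTOFF AVERAGE: SLOW DECREASE ON THE POWER SCALES
# N → N^λ (Kwee 1967 ∕ Móricz 2013, BY NAME from the tree's `Literature.Analysis.Asymptotics.Moricz2013_corollary3_holds`), transported to the lineage's
# range form `(Σ_{n<N} a n∕(n+1))∕H_N`; in that class `ℓ-mean → m ⟺ a → m`; and P2 #54f's witness `sin(log(n+1))` is NOT in it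
# (pure [folklore] SERVICE for the BARE ∕ CUTOFF side of rows L131–L142; imports P2 #54f and the tree's Móricz file).
#   §1 `sum_Icc_one_eq_sum_range` (reindexing Móricz's `Σ_{k∈[1,n]} s k∕k` to `Σ_{j<n} s (j+1)∕(j+1)`), `logMean_eq_moricz` (the two logarithmic means
#      coincide for `s k = a (k − 1)`); **`tendsto_of_logMean_powerScaleSlowlyDecreasing`** (HEADLINE, by name: for every ε > 0 there are N₀ and λ > 1
#      with `a i − a N ≥ −ε` whenever `N₀ ≤ N < i` and `i + 1 ≤ (N + 1)^λ`, and `ℓ-mean → m` ⟹ `a → m`);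
#      **`logMean_iff_tendsto_of_powerScaleSlowlyDecreasing`** (⟸ P2 #54e `logMean_of_tendsto`);
#   §2 **`witness_not_powerScaleSlowlyDecreasing`**: `sin(log(n+1))` — slowly oscillating on the ORDINARY scales N → qN (P2 #54f) — is NOT slowly
#      decreasing on the power scales (else §1 and its ℓ-mean → 0 would force convergence, refuted in P2 #54f): THE TWO-LOOP CLOCK'S CLASS
#      (log-Lipschitz samples, P2 #53b) DOES NOT REACH THE LOGARITHMIC METHOD'S CLASS.
# (β-flow team, prover 2 = lower ∕ positivity side, unit `b2b-balaban-beta-bflow-p2`, gen 37; module P2 #54i; no Erice sentence occurs)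

HONEST FRAMING (page 1 of everything the β sub-cell writes): discharging `BetaPertH` makes Bałaban's UV stability UNCONDITIONAL — a
real constructive-QFT result; it is NOT the continuum limit and NOT the Clay problem.  HONEST DEPENDENCY (cell reorg 2026-08-19,
verbatim): «continuum YM on T⁴ ⇐ BetaPertH ∧ nine spine estimates (0/9 proved); BetaPertH ⇐ (D1) ∧ (D4) ∧ CAP+tail; G-an2-4 gates
asym, D1 and NE2/3/4.»  THIS MODULE DISCHARGES NOTHING and quotes nothing: the Tauberian theorem is the tree's PROVED fact (F. Móricz, Studia Math.
219 (2013) 109–121, Cor. 3 = B. Kwee, Math. Proc. Camb. Phil. Soc. 63 (1967), Lemma 3), here only re-indexed; [folklore] bookkeeping otherwise.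

WHAT THIS FILE PROVES (0 sorry, 0 def): §1 `sum_Icc_one_eq_sum_range`, `logMean_eq_moricz`, **`tendsto_of_logMean_powerScaleSlowlyDecreasing`**,
**`logMean_iff_tendsto_of_powerScaleSlowlyDecreasing`**; §2 **`witness_not_powerScaleSlowlyDecreasing`**.
NOT CLAIMED: Móricz's necessity half and his two-sided ∕ function versions; whether any β-flow clock sampling could supply power-scale slow
decrease (it cannot in general: §2); `BetaPertH`; continuum; Clay.
-/

namespace Summit.QuantumFields.BalabanUV.Beta.EriceFlowEnclosureLogMeanPowerScales

open Finset Filter Topology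
open Summit.QuantumFields.BalabanUV.Beta.EriceFlowEnclosureLogMeanSeq (logMean_of_tendsto)
open Summit.QuantumFields.BalabanUV.Beta.EriceFlowEnclosureLogMeanEscape (witness_logMean_tendsto_zero witness_not_tendsto)

noncomputable section

variable {a : ℕ → ℝ}

/-! ## §1 Móricz ∕ Kwee by name, in range form -/

/-- Reindexing: `Σ_{k ∈ [1, n]} f k = Σ_{j<n} f (j+1)`. [folklore] -/
theorem sum_Icc_one_eq_sum_range (f : ℕ → ℝ) (n : ℕ) : ∑ k ∈ Icc 1 n, f k = ∑ j ∈ range n, f (j + 1) := by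
  induction n with
  | zero => simp
  | succ n ih => rw [sum_Icc_succ_top (by omega), ih, sum_range_succ]

/-- THE TWO LOGARITHMIC MEANS COINCIDE: for `s k := a (k − 1)`, Móricz's `(Σ_{k∈[1,n]} s k∕k)∕(Σ_{k∈[1,n]} 1∕k)` is the lineage's
`(Σ_{j<n} a j∕(j+1))∕(Σ_{j<n} (j+1)⁻¹)`. [folklore] -/
theorem logMean_eq_moricz (a : ℕ → ℝ) (n : ℕ) :
    (∑ k ∈ Icc 1 n, a (k - 1) / k) / (∑ k ∈ Icc 1 n, (1 : ℝ) / k) =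
      (∑ j ∈ range n, ((j : ℝ) + 1)⁻¹ * a j) / ∑ j ∈ range n, ((j : ℝ) + 1)⁻¹ := by
  rw [sum_Icc_one_eq_sum_range (fun k => a (k - 1) / k), sum_Icc_one_eq_sum_range (fun k => (1 : ℝ) / k)]
  congr 1
  · refine sum_congr rfl fun j _ => ?_
    simp only [Nat.add_sub_cancel]; push_cast; rw [div_eq_mul_inv, mul_comm]
  · refine sum_congr rfl fun j _ => ?_
    push_cast; rw [one_div]

/-- **THE LOGARITHMIC TAUBERIAN THEOREM ON THE POWER SCALES, BY NAME (HEADLINE).**  If a is SLOWLY DECREASING ON THE POWER SCALES — for every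
ε > 0 there are N₀ and λ > 1 with `−ε ≤ a i − a N` whenever `N₀ ≤ N < i` and `i + 1 ≤ (N + 1)^λ` — and its logarithmic means
`(Σ_{n<N} a n∕(n+1))∕H_N → m`, then **`a n → m`**.  This is the tree's `Moricz2013_corollary3_holds` (Móricz 2013 Cor. 3 = Kwee 1967 Lemma 3) for
`s k = a (k − 1)`, re-indexed by `logMean_eq_moricz`. [folklore] -/
theorem tendsto_of_logMean_powerScaleSlowlyDecreasing {m : ℝ}
    (hsd : ∀ ε : ℝ, 0 < ε → ∃ (N₀ : ℕ) (l : ℝ), 1 < l ∧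
      ∀ N i : ℕ, N₀ ≤ N → N < i → (i : ℝ) + 1 ≤ ((N : ℝ) + 1) ^ l → -ε ≤ a i - a N)
    (hlog : Tendsto (fun N => (∑ n ∈ range N, ((n : ℝ) + 1)⁻¹ * a n) / ∑ n ∈ range N, ((n : ℝ) + 1)⁻¹) atTop (𝓝 m)) :
    Tendsto a atTop (𝓝 m) := by
  set s : ℕ → ℝ := fun k => a (k - 1) with hs
  -- Móricz's slow decrease for s
  have hsd' : ∀ ε : ℝ, 0 < ε → ∃ (n₀ : ℕ) (l : ℝ), 1 < l ∧
      ∀ n k : ℕ, n₀ ≤ n → n < k → (k : ℝ) ≤ (n : ℝ) ^ l → -ε ≤ s k - s n := by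
    intro ε hε
    obtain ⟨N₀, l, hl, h⟩ := hsd ε hε
    refine ⟨N₀ + 1, l, hl, fun n k hn hnk hkl => ?_⟩
    have hn1 : 1 ≤ n := by omega
    have hk1 : 1 ≤ k := by omega
    have h1 := h (n - 1) (k - 1) (by omega) (by omega) (by
      have e1 : (((k - 1 : ℕ) : ℝ)) + 1 = k := by rw [Nat.cast_sub hk1]; push_cast; ring
      have e2 : (((n - 1 : ℕ) : ℝ)) + 1 = n := by rw [Nat.cast_sub hn1]; push_cast; ring
      rw [e1, e2]; exact hkl)
    simpa only [hs] using h1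
  -- Móricz's logarithmic mean for s is ours
  have hlog' : Tendsto (fun n : ℕ => (∑ k ∈ Icc 1 n, s k / k) / ∑ k ∈ Icc 1 n, (1 : ℝ) / k) atTop (𝓝 m) :=
    hlog.congr fun n => (logMean_eq_moricz a n).symm
  have hconv := Literature.Analysis.Asymptotics.Moricz2013_corollary3_holds s m hsd' hlog'
  -- a n = s (n + 1)
  have := hconv.comp (tendsto_add_atTop_nat 1)
  refine this.congr fun n => ?_
  simp only [Function.comp_apply, hs, Nat.add_sub_cancel]

/-- **IN THE POWER-SCALE CLASS: `ℓ-mean → m ⟺ a → m`** (⟹ the headline; ⟸ regularity, P2 #54e `logMean_of_tendsto`). [folklore] -/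
theorem logMean_iff_tendsto_of_powerScaleSlowlyDecreasing
    (hsd : ∀ ε : ℝ, 0 < ε → ∃ (N₀ : ℕ) (l : ℝ), 1 < l ∧
      ∀ N i : ℕ, N₀ ≤ N → N < i → (i : ℝ) + 1 ≤ ((N : ℝ) + 1) ^ l → -ε ≤ a i - a N) (m : ℝ) :
    Tendsto (fun N => (∑ n ∈ range N, ((n : ℝ) + 1)⁻¹ * a n) / ∑ n ∈ range N, ((n : ℝ) + 1)⁻¹) atTop (𝓝 m) ↔
      Tendsto a atTop (𝓝 m) :=
  ⟨tendsto_of_logMean_powerScaleSlowlyDecreasing hsd, logMean_of_tendsto⟩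

/-! ## §2 The clock's class does not reach the power scales -/

/-- **THE WITNESS IS NOT SLOWLY DECREASING ON THE POWER SCALES**: `a n = sin(log(n+1))` is slowly oscillating on the ordinary scales N → qN, its
logarithmic means tend to 0, and it does not converge (P2 #54f) — so by §1 it cannot be slowly decreasing on the scales N → N^λ.  Hence the
Tauberian class generated by the two-loop clock (log-Lipschitz samples, P2 #53b) is NOT contained in the logarithmic method's class. [folklore] -/
theorem witness_not_powerScaleSlowlyDecreasing :
    ¬ (∀ ε : ℝ, 0 < ε → ∃ (N₀ : ℕ) (l : ℝ), 1 < l ∧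
      ∀ N i : ℕ, N₀ ≤ N → N < i → (i : ℝ) + 1 ≤ ((N : ℝ) + 1) ^ l →
        -ε ≤ Real.sin (Real.log ((i : ℝ) + 1)) - Real.sin (Real.log ((N : ℝ) + 1))) := fun hsd =>
  witness_not_tendsto ⟨0, tendsto_of_logMean_powerScaleSlowlyDecreasing
    (a := fun n : ℕ => Real.sin (Real.log ((n : ℝ) + 1))) hsd witness_logMean_tendsto_zero⟩

end

end Summit.QuantumFields.BalabanUV.Beta.EriceFlowEnclosureLogMeanPowerScales
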